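import Summits.QuantumFields.BalabanUV.T4Continuum.Support.ShellMeasureLandauHolonomyContinuity
import Summits.QuantumFields.BalabanUV.T4Continuum.Support.ShellMeasureRootCompositionLevelZero

/-!
# `T4Continuum.ShellMeasureLandauHolonomyClamp` — END-II (E2′) WITH `hcont` WEAKENED TO CONTINUITY ON THE CHART CUBE:
# the clamp device; E2′'s `hcont` DISCHARGED for the holonomy defined in `ShellMeasureLandauHolonomyChart`
(cell `pub-balaban`, sub-cell `t4`, spine estimate NE7c (node U5b); NE7c formalisation swarm, crew seat
`b2b-balaban-t4-ne7c-formalise-leaf-05` gen 4 — file 2/2 of the REPAIR offered with FINDING F-ne7cleaf05g4-1 (XREAD of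
S22 file 7″ `ShellMeasureLandauHolonomyChart`, p212418; GAPS C-ne7cL05g4-2); imports file 1/2
`ShellMeasureLandauHolonomyContinuity` and E2′ `ShellMeasureRootCompositionLevelZero` (p208890) ONLY; one DATA `def`
(`clamp`, the coordinatewise clamp onto the cube — a function, not a proposition; async audit D-0009), 0
`def … : Prop`, 0 sorry; v1.1 ADDITIVE: §3 `slotAC_realized_su2_of_levelData_cube_contOn'` — the ray binders `hAN`/`hGW`/`hE`
asked on `W V ∩ cube n S` only)

HONEST FRAMING.  Finite four-torus programme, rung (B)+1 only — NOT infinite volume, NOT a mass gap, NOT the Clay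
problem, NOT summit progress; (B), `BetaPertHyp`, (B^μ) not consumed.  NE7c (`T4IndicatorShell.ShellWeightBound`) is
NOT PRINTED and NOT PROVED; «NE7c ⇐ the named binders».  Nothing printed is asserted; every SM-L binder of E2′ stays a
binder.

WHAT THIS FILE DOES.  E2′ (`ShellMeasureRootCompositionLevelZero.slotAC_realized_su2_of_levelData_cube`) asks
`hcont : ∀ V, ∀ p ∈ P_u, Continuous (hol V p)` — global continuity on `Fin n → ℝ` — but reads the dictionary
`hudict`/`hRdict` on the chart cube `[-S,S]ⁿ` only, and (AN-bound) `hAN` along contraction rays `c • x`, `c ∈ [0,1]`.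
* §1 `clamp S` — the coordinatewise clamp `x ↦ (max (−S) (min S (x i)))_i`: continuous (`continuous_clamp`), valued in
  the cube (`clamp_mem_cube`), the identity on the cube (`clamp_eq_self`); so a function continuous ON THE CUBE becomes
  globally continuous after the clamp (`continuous_comp_clamp`) and the classifier is unchanged on the cube
  (`classifier_comp_clamp`).
* §2 `slotAC_realized_su2_of_levelData_cube_contOn` — E2′ WORD FOR WORD with `hcont` REPLACED by
  `hcontOn : ∀ V, ∀ p ∈ P_u, ContinuousOn (hol V p) (cube n S)`; SAME conclusion
  `SlotAntiConcentration ((fieldMeasure P j SU2).withDensity F) u θ ρ (2(n + β Σ_p L̄_p(d̄_p + 4s̄_p) + B_𝓔)/(1−δ))`.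
  Proof: E2′ applied to the clamped holonomy `y ↦ hol V p (clamp S y)`, the window `W V ∩ cube` and the co-test
  `1_cube · Jco V`; `hAN`/`hGW`/`hE` restrict, `hudict`/`hRdict` transfer on the cube, and the centre-monotonicity `hJ`
  transfers because the cube is star-shaped (`ShellMeasureScalingSU2.smul_mem_cube`).
CONSEQUENCE.  For the holonomy DEFINED in `ShellMeasureLandauHolonomyChart` §3 the new binder `hcontOn` is the THEOREM
`ShellMeasureLandauHolonomyContinuity.continuousOn_landauHol_chartRay` (file 1/2): E2′'s `hcont` is DISCHARGED for it
from the displayed binders ((P2), (P4), (118)/(121), (44), (46), (54), `Φ` holomorphic and bounded on its polydisc,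
`0 < S < r_Φ`).  Nothing else moves: `hAN` is inhabited by 7″, `hudict` remains THE dictionary, SM-L2…L6 remain binders;
NE7c NOT PROVED; spine PROVED 0/9.  HONEST DEPENDENCY (cell): continuum YM on T⁴ ⇐ BetaPertH ∧ nine spine estimates
(0/9 proved); BetaPertH ⇐ (D1) ∧ (D4) ∧ CAP+tail; G-an2-4 gates asym, D1 and NE2/3/4.
-/

noncomputable section

open Set Metric NormedSpace Function MeasureTheory

namespace Summit.QuantumFields.BalabanUV.T4Continuum.ShellMeasureLandauHolonomyClamp

open scoped ENNReal
open Literature.MathematicalPhysics.QuantumFieldTheory.Balaban1983to89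
open GaugeField (GaugeInvariant)
open T4ShellMeasure (SlotAntiConcentration)
open T4CubePoincare (cube mem_cube_iff)
open T4CubeChartGnomonic (SU2)
open T4CubeChartExp (expWindowDensity expFibreChart)
open T4ShellMeasureDet (blockLaw)
open T4TreeGaugeFixing (NoClosedLoop fixTo)
open ShellMeasureScalingSU2 (smul_mem_cube)
open ShellMeasureWilsonTrace (TraceData)
open ShellMeasureWilsonMoving (MLetter mwordEval mdFro sSum lSum)
open ShellMeasureLevelAssembly (classifier weight)
open ShellMeasureRootCompositionLevelZero (slotAC_realized_su2_of_levelData_cube)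

/-! ## §1 The clamp onto the chart cube -/

section Clamp

variable {n : ℕ}

/-- **THE COORDINATEWISE CLAMP ONTO THE CUBE `[-S,S]ⁿ`**: `(clamp S x) i = max (−S) (min S (x i))`.  A function, not a
proposition. [folklore] -/
def clamp (S : ℝ) (x : Fin n → ℝ) : Fin n → ℝ := fun i => max (-S) (min S (x i))

/-- the clamp is continuous. [folklore] -/
theorem continuous_clamp (S : ℝ) : Continuous (clamp (n := n) S) :=
  continuous_pi fun i => continuous_const.max (continuous_const.min (continuous_apply i))

/-- the clamp takes values in the cube (`0 ≤ S`). [folklore] -/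
theorem clamp_mem_cube {S : ℝ} (hS : 0 ≤ S) (x : Fin n → ℝ) : clamp S x ∈ cube n S := by
  rw [mem_cube_iff]
  intro i
  rw [abs_le]
  exact ⟨le_max_left _ _, max_le (by linarith) (min_le_left _ _)⟩

/-- the clamp is the identity on the cube. [folklore] -/
theorem clamp_eq_self {S : ℝ} {x : Fin n → ℝ} (hx : x ∈ cube n S) : clamp S x = x := by
  rw [mem_cube_iff] at hx
  funext i
  have h := abs_le.1 (hx i)
  show max (-S) (min S (x i)) = x i
  rw [min_eq_right h.2, max_eq_right h.1]

/-- **A FUNCTION CONTINUOUS ON THE CUBE BECOMES GLOBALLY CONTINUOUS AFTER THE CLAMP.** [folklore] -/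
theorem continuous_comp_clamp {X : Type*} [TopologicalSpace X] {f : (Fin n → ℝ) → X} {S : ℝ} (hS : 0 ≤ S)
    (hf : ContinuousOn f (cube n S)) : Continuous fun x => f (clamp S x) :=
  hf.comp_continuous (continuous_clamp S) (clamp_mem_cube hS)

/-- the classifier of the clamped holonomies agrees with the classifier on the cube. [folklore] -/
theorem classifier_comp_clamp {A ι : Type*} [NormedRing A] {Pu : Finset ι} (hPu : Pu.Nonempty)
    (hol : ι → (Fin n → ℝ) → A) (S : ℝ) {x : Fin n → ℝ} (hx : x ∈ cube n S) :
    classifier hPu (fun p y => hol p (clamp S y)) x = classifier hPu hol x := by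
  simp only [classifier, clamp_eq_self hx]

end Clamp

/-! ## §2 END-II (E2′) with `hcont` weakened to continuity on the chart cube -/

section EndTwoCubeContOn

variable {P : Params} {j : ℕ} [DecidableEq (PBond P j)]
variable {A : Type*} [NormedRing A] [NormedAlgebra ℂ A] [CompleteSpace A] [NormOneClass A]

/-- **END-II, DICTIONARY ON THE CHART CUBE, HOLONOMY CONTINUOUS ON THE CHART CUBE.**  Word for word
`ShellMeasureRootCompositionLevelZero.slotAC_realized_su2_of_levelData_cube` (E2′: data `T`, `U₀`, `Λ`, `e`, `S`, `c`,
`R`, `F`, `hFw`, `hfin`, `u`; level data per exterior `V`: `Ttr`, `P_u`, `hol`, `P_w`, `G`, `𝓔`, `W`, `Jco`, sizes,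
numbers; DICTIONARY `hRdict`/`hudict` on the cube; SM-L5/L6 `hJW`/`hJ`; SM-L1 `hRad`/`hAN`; SM-L3 `hGW`; SM-L4 `hE`;
SM-L2 `hSM`) EXCEPT that `hcont : ∀ V, ∀ p ∈ P_u, Continuous (hol V p)` is REPLACED by
`hcontOn : ∀ V, ∀ p ∈ P_u, ContinuousOn (hol V p) (cube n S)`.  CONCLUSION (unchanged):
`SlotAntiConcentration ((fieldMeasure P j SU2).withDensity F) u θ ρ (2(n + β Σ_p L̄_p(d̄_p + 4s̄_p) + B_𝓔)/(1−δ))`.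
Proof: E2′ for the clamped holonomy `y ↦ hol V p (clamp S y)`, the window `W V ∩ cube` and the co-test `1_cube · Jco V`
(the cube is star-shaped: `smul_mem_cube`).  CONDITIONAL on every binder; nothing PRINTED is asserted; for the
holonomy DEFINED in `ShellMeasureLandauHolonomyChart` §3 the new binder is the theorem
`ShellMeasureLandauHolonomyContinuity.continuousOn_landauHol_chartRay`. [folklore] -/
theorem slotAC_realized_su2_of_levelData_cube_contOn {T : Finset (PBond P j)} (hT : NoClosedLoop T)
    (U₀ : GaugeField P j SU2) (Λ : Finset (PBond P j)) {n : ℕ} (e : ↥Λ × Fin 3 ≃ Fin n)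
    {S : ℝ} (hS : 0 < S) (hSπ : 3 * S ^ 2 < Real.pi ^ 2) (c : GaugeField P j SU2 → GaugeField P j SU2)
    {R : GaugeField P j SU2 → (↥Λ → SU2) → ℝ≥0∞} (hR : ∀ V, Measurable (R V))
    {F : GaugeField P j SU2 → ℝ≥0∞} (hF : Measurable F) (hFi : GaugeInvariant F)
    (hFw : ∀ V y, F (fixTo T U₀ (updateFinset V Λ y)) =
      ENNReal.ofReal (expWindowDensity Λ (c V) S (updateFinset (c V) Λ y)) * R V y)
    (hfin : ∀ V, ((blockLaw Λ).withDensity fun y => F (fixTo T U₀ (updateFinset V Λ y))) univ ≠ ∞)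
    {u : GaugeField P j SU2 → ℝ} (hu : Measurable u) (hui : GaugeInvariant u)
    -- level data per exterior section
    (Ttr : TraceData A) (hN : 0 < Ttr.N) {ι κ : Type*} {Pu : Finset ι} (hPu : Pu.Nonempty)
    (hol : GaugeField P j SU2 → ι → (Fin n → ℝ) → A)
    -- CONTINUITY ON THE CHART CUBE ONLY (this file's weakening of E2′'s global `hcont`)
    (hcontOn : ∀ V, ∀ p ∈ Pu, ContinuousOn (hol V p) (cube n S))
    (Pw : Finset κ) (G : GaugeField P j SU2 → κ → (Fin n → ℝ) → A) (𝓔 : GaugeField P j SU2 → (Fin n → ℝ) → ℝ)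
    (W : GaugeField P j SU2 → Set (Fin n → ℝ)) (Jco : GaugeField P j SU2 → (Fin n → ℝ) → ℝ≥0∞)
    {θ δ ρ β Rad H B𝓔 : ℝ} {sw lw dw : κ → ℝ}
    -- DICTIONARY (block weight: on the chart cube only)
    (hRdict : ∀ V, ∀ x ∈ cube n S,
      R V (expFibreChart Λ (c V) e x) = Jco V x * weight Ttr β Pw (G V) (𝓔 V) x)
    (hudict : ∀ V, ∀ x ∈ cube n S,
      u (fixTo T U₀ (updateFinset V Λ (expFibreChart Λ (c V) e x))) = classifier hPu (hol V) x)
    -- SM-L5/L6: kept co-tests supported in the window, centre-monotone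
    (hJW : ∀ V x, Jco V x ≠ 0 → x ∈ W V)
    (hJ : ∀ V x, ∀ a : ℝ, 0 ≤ a → Jco V x ≤ Jco V (Real.exp (-a) • x))
    -- SM-L1 (AN-bound)
    (hRad : 1 < Rad)
    (hAN : ∀ V, ∀ x ∈ W V, ∀ p ∈ Pu, ∃ f : ℂ → A, DifferentiableOn ℂ f (ball 0 Rad) ∧
      (∀ w ∈ ball (0 : ℂ) Rad, ‖f w‖ ≤ H) ∧ f 0 = 0 ∧ ∀ c' : ℝ, 0 ≤ c' → c' ≤ 1 → f (c' : ℂ) = hol V p (c' • x) - 1)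
    -- SM-L3 graded sectioned words
    (hGW : ∀ V, ∀ x ∈ W V, ∀ p ∈ Pw, ∃ gw : List (MLetter A × ℝ × ℝ), (∀ y ∈ gw, y.1.Good Ttr.τ y.2.1 y.2.2) ∧
      sSum gw ≤ sw p ∧ lSum gw ≤ lw p ∧ mdFro (gw.map Prod.fst) ≤ dw p ∧
      ∀ c' : ℝ, 0 ≤ c' → c' ≤ 1 → mwordEval c' (gw.map Prod.fst) = G V p (c' • x))
    (hsw1 : ∀ p ∈ Pw, sw p ≤ 1) (hsw0 : ∀ p ∈ Pw, 0 ≤ sw p) (hlw0 : ∀ p ∈ Pw, 0 ≤ lw p)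
    (hdw0 : ∀ p ∈ Pw, 0 ≤ dw p)
    -- SM-L4 non-Wilson ray bound
    (hE : ∀ V, ∀ x ∈ W V, ∀ c' : ℝ, 1 / 2 ≤ c' → c' ≤ 1 → 𝓔 V (c' • x) ≤ 𝓔 V x + (1 - c') * B𝓔) (hB𝓔 : 0 ≤ B𝓔)
    -- numbers + SM-L2 (SM)
    (hθ : 0 < θ) (hδ0 : 0 ≤ δ) (hδ1 : δ < 1) (hρ0 : 0 ≤ ρ) (hρ : ρ ≤ (1 - δ) / 2) (hβ : 0 ≤ β)
    (hSM : 36 * H * 1 ^ 2 / (Rad - 1) ^ 2 ≤ δ * θ) :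
    SlotAntiConcentration ((fieldMeasure P j SU2).withDensity F) u θ ρ
      (2 * ((n : ℝ) + (β * ∑ p ∈ Pw, lw p * (dw p + 4 * sw p) + B𝓔)) / (1 - δ)) := by
  refine slotAC_realized_su2_of_levelData_cube hT U₀ Λ e hS hSπ c hR hF hFi hFw hfin hu hui Ttr hN hPu
    (fun V p y => hol V p (clamp S y)) (fun V p hp => continuous_comp_clamp hS.le (hcontOn V p hp)) Pw G 𝓔
    (fun V => W V ∩ cube n S) (fun V x => (cube n S).indicator (fun _ => (1 : ℝ≥0∞)) x * Jco V x)
    ?_ ?_ ?_ ?_ hRad ?_ ?_ hsw1 hsw0 hlw0 hdw0 ?_ hB𝓔 hθ hδ0 hδ1 hρ0 hρ hβ hSM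
  · -- `hRdict` on the cube: the indicator is `1` there
    intro V x hx
    simp only [indicator_of_mem hx, one_mul]
    exact hRdict V x hx
  · -- `hudict` on the cube: the clamp is the identity there
    intro V x hx
    rw [classifier_comp_clamp hPu (hol V) S hx]
    exact hudict V x hx
  · -- `hJW`: the co-test `1_cube · Jco V` lives in `W V ∩ cube`
    intro V x hx
    refine ⟨hJW V x (right_ne_zero_of_mul hx), ?_⟩
    by_contra h
    exact left_ne_zero_of_mul hx (indicator_of_notMem h _)
  · -- `hJ`: centre-monotone, the cube being star-shaped
    intro V x a ha
    by_cases hx : x ∈ cube n S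
    · have hx' : Real.exp (-a) • x ∈ cube n S :=
        smul_mem_cube hx (Real.exp_pos _).le (by rw [Real.exp_le_one_iff]; linarith)
      simp only [indicator_of_mem hx, indicator_of_mem hx', one_mul]
      exact hJ V x a ha
    · simp only [indicator_of_notMem hx, zero_mul]
      exact bot_le
  · -- `hAN` on `W V ∩ cube`: the contraction ray stays in the cube, where the clamp is the identity
    intro V x hx p hp
    obtain ⟨f, hfd, hfb, hf0, hfc⟩ := hAN V x hx.1 p hp
    refine ⟨f, hfd, hfb, hf0, fun c' h0 h1 => ?_⟩
    show f (c' : ℂ) = hol V p (clamp S (c' • x)) - 1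
    rw [hfc c' h0 h1, clamp_eq_self (smul_mem_cube hx.2 h0 h1)]
  · exact fun V x hx p hp => hGW V x hx.1 p hp
  · exact fun V x hx c' h1 h2 => hE V x hx.1 c' h1 h2

end EndTwoCubeContOn

/-! ## §3 (v1.1, additive) The same with the ray binders asked on the window ∩ the cube only -/

section EndTwoCubeContOnInter

variable {P : Params} {j : ℕ} [DecidableEq (PBond P j)]
variable {A : Type*} [NormedRing A] [NormedAlgebra ℂ A] [CompleteSpace A] [NormOneClass A]

/-- **E2′ WITH `hcontOn` AND THE RAY BINDERS ON `W V ∩ [-S,S]ⁿ` ONLY** (v1.1, additive).  Word for word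
`slotAC_realized_su2_of_levelData_cube_contOn` except that (AN-bound) `hAN`, the graded words `hGW` and the non-Wilson
ray bound `hE` are asked for chart points `x ∈ W V ∩ cube n S` only (the chart law vanishes off the cube, so nothing is
lost); same conclusion.  Lets a consumer whose window `W V` is not inside the cube (only the co-test's support matters,
`hJW`) plug ray data that live on the cube — e.g. `ShellMeasureLandauHolonomyChart.hAN_landau_chartRay`, whose disc
radius `r_Φ/S` needs `‖x‖ ≤ S`.  CONDITIONAL on every binder; nothing PRINTED is asserted. [folklore] -/
theorem slotAC_realized_su2_of_levelData_cube_contOn' {T : Finset (PBond P j)} (hT : NoClosedLoop T)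
    (U₀ : GaugeField P j SU2) (Λ : Finset (PBond P j)) {n : ℕ} (e : ↥Λ × Fin 3 ≃ Fin n)
    {S : ℝ} (hS : 0 < S) (hSπ : 3 * S ^ 2 < Real.pi ^ 2) (c : GaugeField P j SU2 → GaugeField P j SU2)
    {R : GaugeField P j SU2 → (↥Λ → SU2) → ℝ≥0∞} (hR : ∀ V, Measurable (R V))
    {F : GaugeField P j SU2 → ℝ≥0∞} (hF : Measurable F) (hFi : GaugeInvariant F)
    (hFw : ∀ V y, F (fixTo T U₀ (updateFinset V Λ y)) =
      ENNReal.ofReal (expWindowDensity Λ (c V) S (updateFinset (c V) Λ y)) * R V y)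
    (hfin : ∀ V, ((blockLaw Λ).withDensity fun y => F (fixTo T U₀ (updateFinset V Λ y))) univ ≠ ∞)
    {u : GaugeField P j SU2 → ℝ} (hu : Measurable u) (hui : GaugeInvariant u)
    -- level data per exterior section
    (Ttr : TraceData A) (hN : 0 < Ttr.N) {ι κ : Type*} {Pu : Finset ι} (hPu : Pu.Nonempty)
    (hol : GaugeField P j SU2 → ι → (Fin n → ℝ) → A)
    -- CONTINUITY ON THE CHART CUBE ONLY
    (hcontOn : ∀ V, ∀ p ∈ Pu, ContinuousOn (hol V p) (cube n S))
    (Pw : Finset κ) (G : GaugeField P j SU2 → κ → (Fin n → ℝ) → A) (𝓔 : GaugeField P j SU2 → (Fin n → ℝ) → ℝ)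
    (W : GaugeField P j SU2 → Set (Fin n → ℝ)) (Jco : GaugeField P j SU2 → (Fin n → ℝ) → ℝ≥0∞)
    {θ δ ρ β Rad H B𝓔 : ℝ} {sw lw dw : κ → ℝ}
    -- DICTIONARY (block weight: on the chart cube only)
    (hRdict : ∀ V, ∀ x ∈ cube n S,
      R V (expFibreChart Λ (c V) e x) = Jco V x * weight Ttr β Pw (G V) (𝓔 V) x)
    (hudict : ∀ V, ∀ x ∈ cube n S,
      u (fixTo T U₀ (updateFinset V Λ (expFibreChart Λ (c V) e x))) = classifier hPu (hol V) x)
    -- SM-L5/L6: kept co-tests supported in the window, centre-monotone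
    (hJW : ∀ V x, Jco V x ≠ 0 → x ∈ W V)
    (hJ : ∀ V x, ∀ a : ℝ, 0 ≤ a → Jco V x ≤ Jco V (Real.exp (-a) • x))
    -- SM-L1 (AN-bound)
    (hRad : 1 < Rad)
    (hAN : ∀ V, ∀ x ∈ W V ∩ cube n S, ∀ p ∈ Pu, ∃ f : ℂ → A, DifferentiableOn ℂ f (ball 0 Rad) ∧
      (∀ w ∈ ball (0 : ℂ) Rad, ‖f w‖ ≤ H) ∧ f 0 = 0 ∧ ∀ c' : ℝ, 0 ≤ c' → c' ≤ 1 → f (c' : ℂ) = hol V p (c' • x) - 1)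
    -- SM-L3 graded sectioned words
    (hGW : ∀ V, ∀ x ∈ W V ∩ cube n S, ∀ p ∈ Pw,
      ∃ gw : List (MLetter A × ℝ × ℝ), (∀ y ∈ gw, y.1.Good Ttr.τ y.2.1 y.2.2) ∧
      sSum gw ≤ sw p ∧ lSum gw ≤ lw p ∧ mdFro (gw.map Prod.fst) ≤ dw p ∧
      ∀ c' : ℝ, 0 ≤ c' → c' ≤ 1 → mwordEval c' (gw.map Prod.fst) = G V p (c' • x))
    (hsw1 : ∀ p ∈ Pw, sw p ≤ 1) (hsw0 : ∀ p ∈ Pw, 0 ≤ sw p) (hlw0 : ∀ p ∈ Pw, 0 ≤ lw p)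
    (hdw0 : ∀ p ∈ Pw, 0 ≤ dw p)
    -- SM-L4 non-Wilson ray bound
    (hE : ∀ V, ∀ x ∈ W V ∩ cube n S, ∀ c' : ℝ, 1 / 2 ≤ c' → c' ≤ 1 → 𝓔 V (c' • x) ≤ 𝓔 V x + (1 - c') * B𝓔)
    (hB𝓔 : 0 ≤ B𝓔)
    -- numbers + SM-L2 (SM)
    (hθ : 0 < θ) (hδ0 : 0 ≤ δ) (hδ1 : δ < 1) (hρ0 : 0 ≤ ρ) (hρ : ρ ≤ (1 - δ) / 2) (hβ : 0 ≤ β)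
    (hSM : 36 * H * 1 ^ 2 / (Rad - 1) ^ 2 ≤ δ * θ) :
    SlotAntiConcentration ((fieldMeasure P j SU2).withDensity F) u θ ρ
      (2 * ((n : ℝ) + (β * ∑ p ∈ Pw, lw p * (dw p + 4 * sw p) + B𝓔)) / (1 - δ)) := by
  refine slotAC_realized_su2_of_levelData_cube hT U₀ Λ e hS hSπ c hR hF hFi hFw hfin hu hui Ttr hN hPu
    (fun V p y => hol V p (clamp S y)) (fun V p hp => continuous_comp_clamp hS.le (hcontOn V p hp)) Pw G 𝓔
    (fun V => W V ∩ cube n S) (fun V x => (cube n S).indicator (fun _ => (1 : ℝ≥0∞)) x * Jco V x)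
    ?_ ?_ ?_ ?_ hRad ?_ hGW hsw1 hsw0 hlw0 hdw0 hE hB𝓔 hθ hδ0 hδ1 hρ0 hρ hβ hSM
  · intro V x hx
    simp only [indicator_of_mem hx, one_mul]
    exact hRdict V x hx
  · intro V x hx
    rw [classifier_comp_clamp hPu (hol V) S hx]
    exact hudict V x hx
  · intro V x hx
    refine ⟨hJW V x (right_ne_zero_of_mul hx), ?_⟩
    by_contra h
    exact left_ne_zero_of_mul hx (indicator_of_notMem h _)
  · intro V x a ha
    by_cases hx : x ∈ cube n S
    · have hx' : Real.exp (-a) • x ∈ cube n S :=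
        smul_mem_cube hx (Real.exp_pos _).le (by rw [Real.exp_le_one_iff]; linarith)
      simp only [indicator_of_mem hx, indicator_of_mem hx', one_mul]
      exact hJ V x a ha
    · simp only [indicator_of_notMem hx, zero_mul]
      exact bot_le
  · intro V x hx p hp
    obtain ⟨f, hfd, hfb, hf0, hfc⟩ := hAN V x hx p hp
    refine ⟨f, hfd, hfb, hf0, fun c' h0 h1 => ?_⟩
    show f (c' : ℂ) = hol V p (clamp S (c' • x)) - 1
    rw [hfc c' h0 h1, clamp_eq_self (smul_mem_cube hx.2 h0 h1)]

end EndTwoCubeContOnInter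

end Summit.QuantumFields.BalabanUV.T4Continuum.ShellMeasureLandauHolonomyClamp
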